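import Summits.ValiantsHypothesis.ValiantsHypothesis.Theorems.KPlusLogSqLawTropicalBMarkedEdgeCyclicOrder

/-!
# Route «KPlusLogSqLaw», crux `TropicalB` (stmt-ValiantsHypothesis-19771) — MARKED-EDGE sector, FOUR-BIT LAW, part 2:
# the common path of two cycles and the ORDER CONTRADICTION for three cycles (pure combinatorics)

HONEST FRAMING.  Helper file (cell `pub-symmetroid`, seat val-sym-trop-p4 (g16), 2026-08-28; `--supports stmt-ValiantsHypothesis-19771
--as helper`).  Second file of the kernel version of the lineage's «MARKED-EDGE FOUR-BIT LAW» (g15, HOME/val-sym-trop-p4/g15/THEOREM-FOURBIT.md,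
Lemmas 4–5).  No design vocabulary; nothing here concerns `TropicalB`, `WeakLifting`, the doors, `MatrixDescartes` (stmt-ValiantsHypothesis-18050)
or VP ≠ VNP.

SETTING.  `X Y : Equiv.Perm V` cycles of a finite type with the «no third cover» property
`hT : ∀ ρ, (∀ i, ρ i = i ∨ ρ i = X i ∨ ρ i = Y i) → ρ = 1 ∨ ρ = X ∨ ρ = Y`.  The COMMON PATH ORDER (written inline, no definition):
«`b` is reached from `a` along common arcs» := `∃ n, (X ^ n) a = b ∧ ∀ k < n, X ((X ^ k) a) = Y ((X ^ k) a)`.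
* `prec_symm` — the order is the same read through `Y`;
* `before_of_prec` — if `b` is reached from `a` along common arcs then, on the cycle `X`, from `a` the point `b` is met before any
  point `c` fixed by `Y`;
* `prec_total` — two distinct points moved by both `X` and `Y` are comparable (uses the theta lemma `divergence_unique` of part 1);
* `order_contradiction` — **the combinatorial heart of the four-bit law**: three cycles `πA, πB, πC` (relative covers `D⁻¹A, D⁻¹B, D⁻¹C`)
  with the fixed/moved points dictated by the patterns `{0,3}, {1,3}, {2,3}` against the base `{0,1,2}` and the pairwise «no third cover»
  property cannot coexist (THEOREM-FOURBIT.md Lemma 5: the common paths `Q_AB ∋ 3,2`, `Q_AC ∋ 3,1`, `Q_BC ∋ 0,3` force incompatible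
  cyclic orders around the marked node `3`).
-/

set_option linter.dupNamespace false
set_option autoImplicit false

namespace Summit.ValiantsHypothesis.ValiantsHypothesis.Theorems.KPlusLogSqLaw
namespace MarkedEdge
namespace FourBit

variable {V : Type*}

/-- Along common arcs the two iterations agree: `(X^k) a = (Y^k) a` for `k ≤ n`. [folklore] -/
theorem pow_eq_pow_of_common (X Y : Equiv.Perm V) {a : V} {n : ℕ} (hc : ∀ k < n, X ((X ^ k) a) = Y ((X ^ k) a)) :
    ∀ k ≤ n, (X ^ k) a = (Y ^ k) a := by
  intro k
  induction k with
  | zero => intro; rfl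
  | succ k ih =>
    intro hk
    rw [pow_succ', Equiv.Perm.mul_apply, pow_succ', Equiv.Perm.mul_apply, ← ih (by omega), hc k (by omega)]

/-- **The common-path order is symmetric in `X`, `Y`.** [this seat's lemma] -/
theorem prec_symm (X Y : Equiv.Perm V) {a b : V}
    (h : ∃ n : ℕ, (X ^ n) a = b ∧ ∀ k < n, X ((X ^ k) a) = Y ((X ^ k) a)) :
    ∃ n : ℕ, (Y ^ n) a = b ∧ ∀ k < n, Y ((Y ^ k) a) = X ((Y ^ k) a) := by
  obtain ⟨n, hn, hc⟩ := h
  have he := pow_eq_pow_of_common X Y hc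
  refine ⟨n, by rw [← he n le_rfl, hn], fun k hk => ?_⟩
  rw [← he k hk.le, hc k hk]

/-- Along common arcs from a point moved by `Y`, every point visited is moved by `Y`. [folklore] -/
theorem moved_of_common (X Y : Equiv.Perm V) {a : V} (haY : Y a ≠ a) {n : ℕ}
    (hc : ∀ k < n, X ((X ^ k) a) = Y ((X ^ k) a)) : ∀ k ≤ n, Y ((X ^ k) a) ≠ (X ^ k) a := by
  intro k
  induction k with
  | zero => intro; simpa using haY
  | succ k ih =>
    intro hk
    have h1 := ih (by omega)
    rw [pow_succ', Equiv.Perm.mul_apply, hc k (by omega)]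
    intro h2
    exact h1 (Y.injective h2)

/-- **Common path ⇒ cyclic order.**  If `b` is reached from `a` (a point moved by `Y`) along common arcs of `X` and `Y`, then on the
cycle `X`, starting from `a`, the point `b` is met before any point `c` fixed by `Y`. [this seat's lemma] -/
theorem before_of_prec (X Y : Equiv.Perm V) {a b c : V} (haY : Y a ≠ a) (hcY : Y c = c)
    (h : ∃ n : ℕ, (X ^ n) a = b ∧ ∀ k < n, X ((X ^ k) a) = Y ((X ^ k) a)) :
    ∃ n : ℕ, (X ^ n) a = b ∧ ∀ k < n, (X ^ k) a ≠ c := by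
  obtain ⟨n, hn, hc⟩ := h
  refine ⟨n, hn, fun k hk heq => ?_⟩
  have := moved_of_common X Y haY hc k hk.le
  rw [heq] at this
  exact this hcY

/-- **Comparability on the common support.**  For cycles `X`, `Y` with the «no third cover» property, two points moved by
both `X` and `Y` are comparable in the common-path order: one is reached from the other along common arcs (trivially so if they coincide).  (Otherwise following `X`
from each towards the other meets a divergence point first; by the theta lemma the two divergence points coincide, and the exponents
then exhibit a return of the cycle `X` strictly before the target — contradiction with minimality.) [this seat's lemma; THEOREM-FOURBIT.md
Lemma 4] -/
theorem prec_total [Finite V] [DecidableEq V] (X Y : Equiv.Perm V) (hX : X.IsCycle) (hY : Y.IsCycle)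
    (hT : ∀ ρ : Equiv.Perm V, (∀ i, ρ i = i ∨ ρ i = X i ∨ ρ i = Y i) → ρ = 1 ∨ ρ = X ∨ ρ = Y)
    {a b : V} (ha : X a ≠ a) (haY : Y a ≠ a) (hb : X b ≠ b) (hbY : Y b ≠ b) :
    (∃ n : ℕ, (X ^ n) a = b ∧ ∀ k < n, X ((X ^ k) a) = Y ((X ^ k) a)) ∨
    (∃ n : ℕ, (X ^ n) b = a ∧ ∀ k < n, X ((X ^ k) b) = Y ((X ^ k) b)) := by
  obtain ⟨n, hn, hnmin⟩ := exists_min_pow_eq X (hX.exists_pow_eq ha hb)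
  obtain ⟨n2, hn2, hn2min⟩ := exists_min_pow_eq X (hX.exists_pow_eq hb ha)
  by_cases h1 : ∀ k < n, X ((X ^ k) a) = Y ((X ^ k) a)
  · exact Or.inl ⟨n, hn, h1⟩
  by_cases h2 : ∀ k < n2, X ((X ^ k) b) = Y ((X ^ k) b)
  · exact Or.inr ⟨n2, hn2, h2⟩
  exfalso
  push Not at h1 h2
  obtain ⟨k1, ⟨hk1n, hk1⟩, hk1min⟩ := exists_min_nat h1
  obtain ⟨k2, ⟨hk2n, hk2⟩, hk2min⟩ := exists_min_nat h2
  -- the two divergence points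
  have hc1 : ∀ k < k1, X ((X ^ k) a) = Y ((X ^ k) a) := by
    intro k hk; by_contra h; exact hk1min k hk ⟨hk.trans hk1n, h⟩
  have hc2 : ∀ k < k2, X ((X ^ k) b) = Y ((X ^ k) b) := by
    intro k hk; by_contra h; exact hk2min k hk ⟨hk.trans hk2n, h⟩
  have hu : X ((X ^ k1) a) ≠ (X ^ k1) a := pow_apply_ne_self X ha k1
  have huY : Y ((X ^ k1) a) ≠ (X ^ k1) a := moved_of_common X Y haY hc1 k1 le_rfl
  have hu' : X ((X ^ k2) b) ≠ (X ^ k2) b := pow_apply_ne_self X hb k2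
  have hu'Y : Y ((X ^ k2) b) ≠ (X ^ k2) b := moved_of_common X Y hbY hc2 k2 le_rfl
  have heq : (X ^ k1) a = (X ^ k2) b := divergence_unique X Y hX hY hT hu huY hk1 hu' hu'Y hk2
  rcases le_or_gt k1 k2 with hle | hlt
  · -- `d := n2 - k2 + k1 ≥ 1` is a period of `a`
    have hper : (X ^ (n2 - k2 + k1)) a = a := by
      rw [pow_add_apply, heq, ← pow_add_apply, Nat.sub_add_cancel hk2n.le, hn2]
    have hperb : (X ^ (n2 - k2 + k1)) b = b := by
      rw [← hn]; exact pow_apply_eq_self_of_pow_apply_eq_self X hper n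
    -- then `(X^(k2 - k1)) b = a`, contradicting the minimality of `n2`
    have : (X ^ (k2 - k1)) b = a := by
      have e : k2 - k1 + (n2 - k2 + k1) = n2 := by omega
      rw [← hn2, ← e, pow_add_apply, hperb]
    exact hn2min (k2 - k1) (by omega) this
  · have hper : (X ^ (n - k1 + k2)) b = b := by
      rw [pow_add_apply, ← heq, ← pow_add_apply, Nat.sub_add_cancel hk1n.le, hn]
    have hpera : (X ^ (n - k1 + k2)) a = a := by
      rw [← hn2]; exact pow_apply_eq_self_of_pow_apply_eq_self X hper n2
    have : (X ^ (k1 - k2)) a = b := by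
      have e : k1 - k2 + (n - k1 + k2) = n := by omega
      rw [← hn, ← e, pow_add_apply, hpera]
    exact hnmin (k1 - k2) (by omega) this

/-- **ORDER CONTRADICTION (combinatorial heart of the marked-edge four-bit law).**  Let `πA, πB, πC` be cycles of a finite type and
`b₀, b₁, b₂, b₃` points with: `πA` fixes `b₀` and moves `b₁, b₂, b₃`; `πB` fixes `b₁` and moves `b₀, b₂, b₃`; `πC` fixes `b₂` and moves
`b₀, b₁, b₃`; and each pair among `πA, πB, πC` has the «no third cover» property.  Then `False`.  (These are the relative covers
`D⁻¹A, D⁻¹B, D⁻¹C` of four dominant marked-edge covers with patterns `{0,1,2}, {0,3}, {1,3}, {2,3}`.)  Proof: comparability gives the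
three common-path orders between `b₃,b₂` (A,B), `b₃,b₁` (A,C), `b₀,b₃` (B,C); read on the cycle `πA` (through `b₁,b₂,b₃`) the first two
are coupled, on `πB` (through `b₀,b₂,b₃`) the first and third, on `πC` (through `b₀,b₁,b₃`) the last two — with one sign flip in total.
[this seat's theorem; THEOREM-FOURBIT.md Lemma 5] -/
theorem order_contradiction [Finite V] [DecidableEq V] (πA πB πC : Equiv.Perm V)
    (hA : πA.IsCycle) (hB : πB.IsCycle) (hC : πC.IsCycle) {b₀ b₁ b₂ b₃ : V}
    (hA0 : πA b₀ = b₀) (hA1 : πA b₁ ≠ b₁) (hA2 : πA b₂ ≠ b₂) (hA3 : πA b₃ ≠ b₃)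
    (hB1 : πB b₁ = b₁) (hB0 : πB b₀ ≠ b₀) (hB2 : πB b₂ ≠ b₂) (hB3 : πB b₃ ≠ b₃)
    (hC2 : πC b₂ = b₂) (hC0 : πC b₀ ≠ b₀) (hC1 : πC b₁ ≠ b₁) (hC3 : πC b₃ ≠ b₃)
    (hTAB : ∀ ρ : Equiv.Perm V, (∀ i, ρ i = i ∨ ρ i = πA i ∨ ρ i = πB i) → ρ = 1 ∨ ρ = πA ∨ ρ = πB)
    (hTAC : ∀ ρ : Equiv.Perm V, (∀ i, ρ i = i ∨ ρ i = πA i ∨ ρ i = πC i) → ρ = 1 ∨ ρ = πA ∨ ρ = πC)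
    (hTBC : ∀ ρ : Equiv.Perm V, (∀ i, ρ i = i ∨ ρ i = πB i ∨ ρ i = πC i) → ρ = 1 ∨ ρ = πB ∨ ρ = πC) : False := by
  -- distinctness of the marked points
  have h01 : b₀ ≠ b₁ := fun h => hA1 (h ▸ hA0)
  have h02 : b₀ ≠ b₂ := fun h => hA2 (h ▸ hA0)
  have h12 : b₁ ≠ b₂ := fun h => hB2 (h ▸ hB1)
  have h13 : b₁ ≠ b₃ := fun h => hB3 (h ▸ hB1)
  have h23 : b₂ ≠ b₃ := fun h => hC3 (h ▸ hC2)
  have h03 : b₀ ≠ b₃ := fun h => hA3 (h ▸ hA0)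
  -- orbits: every moved point is reachable from every moved point on a cycle
  have rA : ∀ {x y : V}, πA x ≠ x → πA y ≠ y → ∃ n : ℕ, (πA ^ n) x = y := fun hx hy => hA.exists_pow_eq hx hy
  have rB : ∀ {x y : V}, πB x ≠ x → πB y ≠ y → ∃ n : ℕ, (πB ^ n) x = y := fun hx hy => hB.exists_pow_eq hx hy
  have rC : ∀ {x y : V}, πC x ≠ x → πC y ≠ y → ∃ n : ℕ, (πC ^ n) x = y := fun hx hy => hC.exists_pow_eq hx hy
  -- the three comparabilities
  have pAB := prec_total πA πB hA hB hTAB hA3 hB3 hA2 hB2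
  have pAC := prec_total πA πC hA hC hTAC hA3 hC3 hA1 hC1
  have pBC := prec_total πB πC hB hC hTBC hB0 hC0 hB3 hC3
  -- read each comparability as cyclic orders on the cycles through the relevant marked points
  -- on πA (moves b₁ b₂ b₃): Q_AB avoids b₁ (πB fixes b₁), Q_AC avoids b₂ (πC fixes b₂)
  -- on πB (moves b₀ b₂ b₃): Q_AB avoids b₀ (πA fixes b₀), Q_BC avoids b₂
  -- on πC (moves b₀ b₁ b₃): Q_AC avoids b₀, Q_BC avoids b₁
  rcases pAB with p | q
  · -- `b₃ ≺ b₂` in Q_AB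
    have a1 : ∃ n : ℕ, (πA ^ n) b₃ = b₂ ∧ ∀ k < n, (πA ^ k) b₃ ≠ b₁ := before_of_prec πA πB hB3 hB1 p
    have b1' : ∃ n : ℕ, (πB ^ n) b₃ = b₂ ∧ ∀ k < n, (πB ^ k) b₃ ≠ b₀ := before_of_prec πB πA hA3 hA0 (prec_symm πA πB p)
    rcases pAC with r | r'
    · -- `b₃ ≺ b₁` in Q_AC: on πA, from b₃ both b₂-before-b₁ and b₁-before-b₂
      have a2 : ∃ n : ℕ, (πA ^ n) b₃ = b₁ ∧ ∀ k < n, (πA ^ k) b₃ ≠ b₂ := before_of_prec πA πC hC3 hC2 r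
      exact h12 (eq_of_before_of_before πA a2 a1)
    · -- `b₁ ≺ b₃` in Q_AC
      have c2 : ∃ n : ℕ, (πC ^ n) b₁ = b₃ ∧ ∀ k < n, (πC ^ k) b₁ ≠ b₀ := before_of_prec πC πA hA1 hA0 (prec_symm πA πC r')
      -- rotate on πC: from b₃, b₀ before b₁
      have c2' : ∃ n : ℕ, (πC ^ n) b₃ = b₀ ∧ ∀ k < n, (πC ^ k) b₃ ≠ b₁ := before_rotate πC h13 c2 (rC hC1 hC0)
      rcases pBC with s | s'
      · -- `b₀ ≺ b₃` in Q_BC: on πC from b₀, b₃ before b₁; rotate: from b₃, b₁ before b₀ — contradiction with c2'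
        have c3 : ∃ n : ℕ, (πC ^ n) b₀ = b₃ ∧ ∀ k < n, (πC ^ k) b₀ ≠ b₁ := before_of_prec πC πB hB0 hB1 (prec_symm πB πC s)
        have c3' : ∃ n : ℕ, (πC ^ n) b₃ = b₁ ∧ ∀ k < n, (πC ^ k) b₃ ≠ b₀ := before_rotate πC h03 c3 (rC hC0 hC1)
        exact h01 (eq_of_before_of_before πC c2' c3')
      · -- `b₃ ≺ b₀` in Q_BC: on πB from b₃, b₀ before b₂ — against b1' (from b₃, b₂ before b₀)
        have b3 : ∃ n : ℕ, (πB ^ n) b₃ = b₀ ∧ ∀ k < n, (πB ^ k) b₃ ≠ b₂ := before_of_prec πB πC hC3 hC2 s'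
        exact h02 (eq_of_before_of_before πB b3 b1')
  · -- `b₂ ≺ b₃` in Q_AB
    have a1 : ∃ n : ℕ, (πA ^ n) b₂ = b₃ ∧ ∀ k < n, (πA ^ k) b₂ ≠ b₁ := before_of_prec πA πB hB2 hB1 q
    have a1' : ∃ n : ℕ, (πA ^ n) b₃ = b₁ ∧ ∀ k < n, (πA ^ k) b₃ ≠ b₂ := before_rotate πA h23 a1 (rA hA2 hA1)
    have b1 : ∃ n : ℕ, (πB ^ n) b₂ = b₃ ∧ ∀ k < n, (πB ^ k) b₂ ≠ b₀ := before_of_prec πB πA hA2 hA0 (prec_symm πA πB q)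
    have b1' : ∃ n : ℕ, (πB ^ n) b₃ = b₀ ∧ ∀ k < n, (πB ^ k) b₃ ≠ b₂ := before_rotate πB h23 b1 (rB hB2 hB0)
    rcases pAC with r | r'
    · -- `b₃ ≺ b₁` in Q_AC: on πC from b₃, b₁ before b₀
      have c2 : ∃ n : ℕ, (πC ^ n) b₃ = b₁ ∧ ∀ k < n, (πC ^ k) b₃ ≠ b₀ := before_of_prec πC πA hA3 hA0 (prec_symm πA πC r)
      rcases pBC with s | s'
      · -- `b₀ ≺ b₃` in Q_BC: on πB from b₀, b₃ before b₂; rotate: from b₃, b₂ before b₀ — against b1'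
        have b3 : ∃ n : ℕ, (πB ^ n) b₀ = b₃ ∧ ∀ k < n, (πB ^ k) b₀ ≠ b₂ := before_of_prec πB πC hC0 hC2 s
        have b3' : ∃ n : ℕ, (πB ^ n) b₃ = b₂ ∧ ∀ k < n, (πB ^ k) b₃ ≠ b₀ := before_rotate πB h03 b3 (rB hB0 hB2)
        exact h02 (eq_of_before_of_before πB b1' b3')
      · -- `b₃ ≺ b₀` in Q_BC: on πC from b₃, b₀ before b₁ — against c2
        have c3 : ∃ n : ℕ, (πC ^ n) b₃ = b₀ ∧ ∀ k < n, (πC ^ k) b₃ ≠ b₁ := before_of_prec πC πB hB3 hB1 (prec_symm πB πC s')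
        exact h01 (eq_of_before_of_before πC c3 c2)
    · -- `b₁ ≺ b₃` in Q_AC: on πA from b₁, b₃ before b₂; rotate: from b₃, b₂ before b₁ — against a1'
      have a2 : ∃ n : ℕ, (πA ^ n) b₁ = b₃ ∧ ∀ k < n, (πA ^ k) b₁ ≠ b₂ := before_of_prec πA πC hC1 hC2 r'
      have a2' : ∃ n : ℕ, (πA ^ n) b₃ = b₂ ∧ ∀ k < n, (πA ^ k) b₃ ≠ b₁ := before_rotate πA h13 a2 (rA hA1 hA2)
      exact h12 (eq_of_before_of_before πA a1' a2')

end FourBit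
end MarkedEdge
end Summit.ValiantsHypothesis.ValiantsHypothesis.Theorems.KPlusLogSqLaw
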